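import Summits.NavierStokesRegularity.NavierStokesRegularity.Theses.QuantisedSymmetry
import Summits.NavierStokesRegularity.NavierStokesRegularity.Theses.Blowup
import Summits.NavierStokesRegularity.NavierStokesRegularity.Theorems.QuantisedSymmetryPolyhedralTruncationBridge
import Summits.NavierStokesRegularity.NavierStokesRegularity.Theorems.QuantisedSymmetryPolyhedralDssProfileExistsDominatesBlowupProfile
import Summits.NavierStokesRegularity.NavierStokesRegularity.Theorems.QuantisedSymmetryLiouvilleKillsProfile
import Summits.NavierStokesRegularity.NavierStokesRegularity.Theorems.FilamentSkeletonRssRdssProfileTruncation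
import Summits.NavierStokesRegularity.NavierStokesRegularity.Theorems.QuantisedSymmetryPolyhedralDssProfileExistsOfCell
import Summits.NavierStokesRegularity.NavierStokesRegularity.Theorems.QuantisedSymmetryPolyhedralDssProfileExistsCellOfProfile
import HarnessLib

/-!
# Strategist sketch S19·g5 (census family `s`, generation 5, INDEPENDENT) for the crux
  `QuantisedSymmetry.PolyhedralDssProfileExists` (stmt-NavierStokesRegularity-1404)

Companion of `STRATEGY-CENSUS-s19.md` (gen 5).  Every declaration here is either a DEFINITION of a
candidate station / piece / strengthening named in the census, or a SORRY-FREE implication between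
such stations built from LANDED tree theorems.  Nothing here proves or refutes an open item.

Sections
0. `crux_decides` — the crux ALONE refutes Clay (A) by tree theorems (route `closes` + landed
   `PolyhedralTruncationBridge` + landed `ClayUniqueness`), so "short of the summit" must mean
   "strictly weaker than the crux AND still feeding `closes`", or "a decomposition none of whose
   pieces is the crux".
1. Weaker intermediates W₁ (stmt-0155), W₂ (X5a), W₃, W₆, W₈ with the implications
   crux → W₁ → W₂ → ¬S (all landed), crux → W₃/W₆/W₈ (non-deciding).
2. Decompositions D-A (approximate cells ∧ compactness) and D-C (¬Liouville ∧ periodic selection),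
   typed, with their (trivial) assemblies.
3. Strengthenings S⁺₁ (steady polyhedral profile), S⁺₂ (rotating polyhedral profile) as defs.
-/

namespace Summit.NavierStokesRegularity.NavierStokesRegularity.Cruxes.PolyhedralDssProfileExists.StrategistS19g5

open MeasureTheory Set
open Literature.Analysis.FluidPDE
open Summit.NavierStokesRegularity.NavierStokesRegularity.Theses

noncomputable section

local notation "E3" => EuclideanSpace ℝ (Fin 3)

/-- The crux under census (by name). -/
abbrev Crux : Prop := QuantisedSymmetry.PolyhedralDssProfileExists

/-- The polyhedral group clauses shared by every station below: `G` finite, proper rotations,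
irreducible on `ℝ³`. -/
def IsPolyhedralGroup (G : Subgroup (E3 ≃ₗᵢ[ℝ] E3)) : Prop :=
  Finite G ∧ (∀ g ∈ G, LinearMap.det (g.toLinearEquiv : E3 →ₗ[ℝ] E3) = 1) ∧
    (∀ V : Submodule ℝ E3, (∀ g ∈ G, ∀ v ∈ V, g v ∈ V) → V = ⊥ ∨ V = ⊤)

/-! ## 0. The crux alone decides ¬S (landed) -/

/-- **X⁻ ⊢ ¬NavierStokesRegularity by tree theorems only.** The route's deciding theorem `closes`
with its two other binders discharged by the LANDED `quantisedSymmetry_polyhedralTruncationBridge_proof`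
and `ClayUniqueness_holds`.  Consequence for the census: any LOSSLESS replacement of the crux that still
feeds `closes` is itself a refutation of Clay (A). -/
theorem crux_decides (hX : Crux) : ¬ _root_.NavierStokesRegularity :=
  QuantisedSymmetry.closes hX Theorems.quantisedSymmetry_polyhedralTruncationBridge_proof
    QuantisedSymmetry.ClayUniqueness_holds

/-! ## 1. Strictly weaker intermediates -/

/-- **W₁ (drop the symmetry group): crux → `Blowup.BlowupTypeIDssProfile`** (stmt-0155; landed
`stub_dominatesBlowupProfile`). -/
theorem crux_implies_W1 : Crux → Blowup.BlowupTypeIDssProfile :=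
  Theorems.PolyhedralDssProfileExists.PolyhedralCell.stub_dominatesBlowupProfile

/-- **W₁ → W₂ = X5a (`Blowup.BlowupExists`)**, by the LANDED conjecture-free truncation bridge
`filamentSkeletonRss_rdssProfileTruncation_proof` (stmt-11289): a failure of Tsai's Type-I (rotated)
λ-DSS Liouville statement at any factor is a nontrivial Type-I (rotated) DSS ancient mild solution,
which the bridge truncates to a rapidly decaying datum with finite classical lifespan. -/
theorem W1_implies_W2 (h : Blowup.BlowupTypeIDssProfile) : Blowup.BlowupExists := by
  by_contra hne
  apply h
  intro c
  refine ⟨?_, fun R => ?_⟩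
  · intro hc u hanc hmeas hdss hdec
    by_contra hnt
    exact hne (Theorems.filamentSkeletonRss_rdssProfileTruncation_proof
      ⟨c, LinearIsometryEquiv.refl ℝ _, u, hc, hanc, hmeas, isRotatedDSS_refl_iff.mpr hdss, hdec, hnt⟩)
  · intro hc u hanc hmeas hrdss hdec
    by_contra hnt
    exact hne (Theorems.filamentSkeletonRss_rdssProfileTruncation_proof
      ⟨c, R, u, hc, hanc, hmeas, hrdss, hdec, hnt⟩)

/-- **W₂ decides**: X5a plus the LANDED Clay-class uniqueness refutes Clay (A) (route Blowup's
`closes`). -/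
theorem W2_decides (h : Blowup.BlowupExists) : ¬ _root_.NavierStokesRegularity :=
  Blowup.closes h Blowup.BlowupClayUniqueness_holds

/-- **W₁ decides** (so stmt-0155 is not "short of the summit" either). -/
theorem W1_decides (h : Blowup.BlowupTypeIDssProfile) : ¬ _root_.NavierStokesRegularity :=
  W2_decides (W1_implies_W2 h)

/-- The chain crux → W₁ → W₂ → ¬S, composed. -/
theorem crux_decides' (hX : Crux) : ¬ _root_.NavierStokesRegularity :=
  W1_decides (crux_implies_W1 hX)

/-- **W₃ (non-deciding consequence): crux → ¬`PolyhedralTypeILiouville`** (the kill switch #3 fails),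
by the LANDED `quantisedSymmetry_liouvilleKillsProfile_proof`.  W₃ asserts a nontrivial BOUNDED
polyhedral Type-I-decaying ancient mild solution; it does not feed `closes` (no periodicity, no
blow-up). -/
theorem crux_implies_W3 (hX : Crux) : ¬ QuantisedSymmetry.PolyhedralTypeILiouville := by
  intro hL
  exact Theorems.quantisedSymmetry_liouvilleKillsProfile_proof hL hX

/-- **W₆ (drop the Type-I space–time decay)**: a nontrivial polyhedral λ-DSS ancient mild solution,
no decay clause. Strictly weaker as typed; does not feed `closes` (the truncation bridge consumes
`HasTypeIDecay`). -/
def DssProfileNoDecay : Prop :=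
  ∃ G : Subgroup (E3 ≃ₗᵢ[ℝ] E3), IsPolyhedralGroup G ∧ ∃ c : ℝ, 1 < c ∧ ∃ u : ℝ → E3 → E3,
    IsAncientMildSolution 1 u ∧ (∀ t < 0, AEStronglyMeasurable (u t) volume) ∧
      IsDiscretelySelfSimilar c u ∧ (∀ g ∈ G, ∀ t x, u t (g x) = g (u t x)) ∧
        ¬ (∀ t < 0, u t =ᵐ[volume] 0)

theorem crux_implies_W6 (hX : Crux) : DssProfileNoDecay := by
  obtain ⟨G, hfin, hdet, hirr, c, hc, u, hanc, hmeas, hdss, -, heqv, hnt⟩ := hX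
  exact ⟨G, ⟨hfin, hdet, hirr⟩, c, hc, u, hanc, hmeas, hdss, heqv, hnt⟩

/-- **W₈ (drop discrete self-similarity)**: a nontrivial polyhedral ancient mild solution with Type-I
space–time decay (= failure of the polyhedral case of the WEAK Liouville statement in the unbounded
Type-I class). Strictly weaker as typed; non-deciding (such a solution need not be singular at t = 0). -/
def TypeIAncientNontrivial : Prop :=
  ∃ G : Subgroup (E3 ≃ₗᵢ[ℝ] E3), IsPolyhedralGroup G ∧ ∃ u : ℝ → E3 → E3,
    IsAncientMildSolution 1 u ∧ (∀ t < 0, AEStronglyMeasurable (u t) volume) ∧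
      (∃ C₀ : ℝ, HasTypeIDecay C₀ u) ∧ (∀ g ∈ G, ∀ t x, u t (g x) = g (u t x)) ∧
        ¬ (∀ t < 0, u t =ᵐ[volume] 0)

theorem crux_implies_W8 (hX : Crux) : TypeIAncientNontrivial := by
  obtain ⟨G, hfin, hdet, hirr, c, -, u, hanc, hmeas, -, hdec, heqv, hnt⟩ := hX
  exact ⟨G, ⟨hfin, hdet, hirr⟩, u, hanc, hmeas, hdec, heqv, hnt⟩

/-! ## 2. Decompositions -/

/-- The body of the line's cell stub (`PolyhedralCell.PolyhedralCellExists`, restated verbatim so that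
`stub_profileOfPolyhedralCell` applies by `rfl`). -/
def PolyhedralCellExists' : Prop :=
  ∃ G : Subgroup (EuclideanSpace ℝ (Fin 3) ≃ₗᵢ[ℝ] EuclideanSpace ℝ (Fin 3)), Finite G ∧
    (∀ g ∈ G, LinearMap.det (g.toLinearEquiv : EuclideanSpace ℝ (Fin 3) →ₗ[ℝ] EuclideanSpace ℝ (Fin 3)) = 1) ∧
    (∀ V : Submodule ℝ (EuclideanSpace ℝ (Fin 3)), (∀ g ∈ G, ∀ v ∈ V, g v ∈ V) → V = ⊥ ∨ V = ⊤) ∧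
    ∃ c : ℝ, 1 < c ∧ ∃ v : ℝ → EuclideanSpace ℝ (Fin 3) → EuclideanSpace ℝ (Fin 3),
      (ContinuousOn (Function.uncurry v) (Set.Icc (-1 : ℝ) (-(c ^ 2)⁻¹) ×ˢ Set.univ) ∧
        (∃ M : ℝ, ∀ t ∈ Set.Icc (-1 : ℝ) (-(c ^ 2)⁻¹), ∀ x, ‖v t x‖ ≤ M) ∧
        (∀ t ∈ Set.Icc (-1 : ℝ) (-(c ^ 2)⁻¹), IsWeaklyDivFree (v t)) ∧
        (∀ s t : ℝ, -1 ≤ s → s < t → t ≤ -(c ^ 2)⁻¹ → ∀ x,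
          v t x = heatFlow (v s) (t - s) x - oseenDuhamel 1 s v v t x) ∧
        (∀ x, v (-(c ^ 2)⁻¹) x = c • v (-1) (c • x)) ∧
        (∀ g ∈ G, ∀ t ∈ Set.Icc (-1 : ℝ) (-(c ^ 2)⁻¹), ∀ x, v t (g x) = g (v t x))) ∧
      MemLp (v (-1)) 4 volume ∧ ¬ (v (-1) =ᵐ[volume] 0)

/-- The landed equivalence, by name: crux ↔ one polyhedral cell. -/
theorem crux_iff_cell : Crux ↔ PolyhedralCellExists' :=
  Theorems.PolyhedralDssProfileExists.PolyhedralCell.polyhedralDssProfileExists_iff_cell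

/-- **D-A, piece data: an ε-APPROXIMATE polyhedral cell with uniform floors.**  The cell body with
the junction identity `v(-c⁻²)(x) = c·v(-1)(cx)` relaxed to a sup-defect `≤ ε`, a UNIFORM Type-I
envelope `M/(‖x‖+1)` (so that limits stay in `L⁴`), and a quantitative non-triviality floor `δ` at
some point of the ball of radius `R` on the final slice. -/
def IsApproxPolyhedralCell (G : Subgroup (E3 ≃ₗᵢ[ℝ] E3)) (c ε M R δ : ℝ) (v : ℝ → E3 → E3) : Prop :=
  ContinuousOn (Function.uncurry v) (Set.Icc (-1 : ℝ) (-(c ^ 2)⁻¹) ×ˢ Set.univ) ∧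
    (∀ t ∈ Set.Icc (-1 : ℝ) (-(c ^ 2)⁻¹), ∀ x, ‖v t x‖ ≤ M / (‖x‖ + 1)) ∧
    (∀ t ∈ Set.Icc (-1 : ℝ) (-(c ^ 2)⁻¹), IsWeaklyDivFree (v t)) ∧
    (∀ s t : ℝ, -1 ≤ s → s < t → t ≤ -(c ^ 2)⁻¹ → ∀ x,
      v t x = heatFlow (v s) (t - s) x - oseenDuhamel 1 s v v t x) ∧
    (∀ x, ‖v (-(c ^ 2)⁻¹) x - c • v (-1) (c • x)‖ ≤ ε) ∧
    (∀ g ∈ G, ∀ t ∈ Set.Icc (-1 : ℝ) (-(c ^ 2)⁻¹), ∀ x, v t (g x) = g (v t x)) ∧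
    (∃ x : E3, ‖x‖ ≤ R ∧ δ ≤ ‖v (-(c ^ 2)⁻¹) x‖)

/-- **D-A, piece 1 (`ApproxPolyhedralCells`)**: for ONE polyhedral group and ONE window of factors
and floors, ε-approximate cells exist for every ε > 0. -/
def ApproxPolyhedralCells : Prop :=
  ∃ G : Subgroup (E3 ≃ₗᵢ[ℝ] E3), IsPolyhedralGroup G ∧
    ∃ c₁ c₂ M R δ : ℝ, 1 < c₁ ∧ c₁ ≤ c₂ ∧ 0 < δ ∧
      ∀ ε > 0, ∃ c ∈ Set.Icc c₁ c₂, ∃ v : ℝ → E3 → E3, IsApproxPolyhedralCell G c ε M R δ v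

/-- **D-A, piece 2 (`CellCompactness`)**: approximate cells with uniform floors accumulate at an exact
cell (Arzelà–Ascoli from interior parabolic smoothing of bounded Oseen-mild fields, limit in the
Duhamel identity by dominated convergence under the uniform envelope, junction defect → 0, floor and
envelope pass to the limit, `L⁴` from the envelope).  Plausibly PROVABLE (M-sized real analysis). -/
def CellCompactness : Prop := ApproxPolyhedralCells → PolyhedralCellExists'

/-- **D-A assembly** (sorry-free): piece 1 → piece 2 → crux. -/
theorem crux_of_DA (h₁ : ApproxPolyhedralCells) (h₂ : CellCompactness) : Crux :=
  crux_iff_cell.mpr (h₂ h₁)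

/-- **D-A collapse witness (ε = 0 end)**: an EXACT cell obeying the same envelope and floor is an
ε-approximate cell for every ε ≥ 0 — i.e. piece 1 at ε = 0 is the cell stub itself with its (WLOG,
by the landed floors N2/N5/N13) normalisations; piece 1 is the crux in quantitative dress. -/
theorem approxCell_of_exactCell {G : Subgroup (E3 ≃ₗᵢ[ℝ] E3)} {c M R δ : ℝ} {v : ℝ → E3 → E3}
    (hcont : ContinuousOn (Function.uncurry v) (Set.Icc (-1 : ℝ) (-(c ^ 2)⁻¹) ×ˢ Set.univ))
    (henv : ∀ t ∈ Set.Icc (-1 : ℝ) (-(c ^ 2)⁻¹), ∀ x, ‖v t x‖ ≤ M / (‖x‖ + 1))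
    (hdiv : ∀ t ∈ Set.Icc (-1 : ℝ) (-(c ^ 2)⁻¹), IsWeaklyDivFree (v t))
    (hmild : ∀ s t : ℝ, -1 ≤ s → s < t → t ≤ -(c ^ 2)⁻¹ → ∀ x,
      v t x = heatFlow (v s) (t - s) x - oseenDuhamel 1 s v v t x)
    (hjun : ∀ x, v (-(c ^ 2)⁻¹) x = c • v (-1) (c • x))
    (heqv : ∀ g ∈ G, ∀ t ∈ Set.Icc (-1 : ℝ) (-(c ^ 2)⁻¹), ∀ x, v t (g x) = g (v t x))
    (hfloor : ∃ x : E3, ‖x‖ ≤ R ∧ δ ≤ ‖v (-(c ^ 2)⁻¹) x‖) {ε : ℝ} (hε : 0 ≤ ε) :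
    IsApproxPolyhedralCell G c ε M R δ v := by
  refine ⟨hcont, henv, hdiv, hmild, fun x => ?_, heqv, hfloor⟩
  rw [hjun x, sub_self, norm_zero]
  exact hε

/-- **D-C, piece 2 (`PeriodicSelection`)**: from a failure of the polyhedral Type-I Liouville theorem
(some nontrivial BOUNDED polyhedral Type-I-decaying ancient mild solution) SELECT a discretely
self-similar one — a closing / periodic-orbit-selection lemma for the scaling flow on the polyhedral
Type-I ancient class.  No tool in print or in tree (minimal sets of the scaling flow need not be
periodic orbits: route RecurrentProfiles' X1 stops at uniformly recurrent profiles). -/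
def PeriodicSelection : Prop := ¬ QuantisedSymmetry.PolyhedralTypeILiouville → Crux

/-- **D-C assembly** (sorry-free, trivial seam): ¬#3 → (¬#3 → #2) → #2. -/
theorem crux_of_DC (h₁ : ¬ QuantisedSymmetry.PolyhedralTypeILiouville) (h₂ : PeriodicSelection) : Crux :=
  h₂ h₁

/-- D-C piece 1 is a CONSEQUENCE of the crux (landed), so the split is `W₃ ∧ (W₃ → X⁻)` with W₃
strictly weaker and non-deciding: admissible in shape, empty in plan (see census § Decomposition). -/
theorem DC_piece1_of_crux (hX : Crux) : ¬ QuantisedSymmetry.PolyhedralTypeILiouville :=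
  crux_implies_W3 hX

/-! ## 3. Strengthenings (defs only; status argued in the census) -/

/-- **S⁺₁ (steady polyhedral profile)**: a polyhedral Type-I ancient mild solution which is
self-similar for EVERY factor (a Leray backward self-similar solution).  Refuted in substance by the
LANDED `Literature.Analysis.FluidPDE.tsai_selfsimilar_holds` (Tsai 1998 Thm 1: a `C²` Leray profile in
`L^q`, `3 < q < ∞`, vanishes; Type-I decay puts the profile in every `L^q`, `q > 3`), modulo the
profile-regularity bookkeeping `ancient mild + self-similar ⇒ IsLerayProfile`. -/
def SteadyPolyhedralProfile : Prop :=
  ∃ G : Subgroup (E3 ≃ₗᵢ[ℝ] E3), IsPolyhedralGroup G ∧ ∃ u : ℝ → E3 → E3,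
    IsAncientMildSolution 1 u ∧ (∀ t < 0, AEStronglyMeasurable (u t) volume) ∧
      IsSelfSimilar u ∧ (∃ C₀ : ℝ, HasTypeIDecay C₀ u) ∧ (∀ g ∈ G, ∀ t x, u t (g x) = g (u t x)) ∧
        ¬ (∀ t < 0, u t =ᵐ[volume] 0)

/-- S⁺₁ is indeed a strengthening of the crux (self-similar ⇒ 2-DSS). -/
theorem crux_of_steady (h : SteadyPolyhedralProfile) : Crux := by
  obtain ⟨G, ⟨hfin, hdet, hirr⟩, u, hanc, hmeas, hss, hdec, heqv, hnt⟩ := h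
  exact ⟨G, hfin, hdet, hirr, 2, by norm_num, u, hanc, hmeas,
    hss.isDiscretelySelfSimilar (by norm_num), hdec, heqv, hnt⟩

/-- **S⁺₂ (rotating polyhedral profile, RSS with angular speed α ≠ 0 about an axis `e`)**: the profile
is rotated-DSS for every factor `c > 0` with the rotation by angle `2α log c` about `e`.  Trivial by
pure symmetry: `G`-equivariance at all times forces equivariance of the slice under every conjugate
`R(θ) g R(−θ)`, whose closure is `SO(3)` for irreducible `G` not inside the axial `O(2)`; a smooth
`SO(3)`-equivariant solenoidal field decaying at infinity is zero.  Recorded as a def only. -/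
def RotatingPolyhedralProfile : Prop :=
  ∃ G : Subgroup (E3 ≃ₗᵢ[ℝ] E3), IsPolyhedralGroup G ∧ ∃ α : ℝ, α ≠ 0 ∧
    ∃ Rot : ℝ → (E3 ≃ₗᵢ[ℝ] E3), (∀ θ φ, Rot (θ + φ) = (Rot θ).trans (Rot φ)) ∧ (∃ θ, Rot θ ≠ LinearIsometryEquiv.refl ℝ E3) ∧
    ∃ u : ℝ → E3 → E3,
      IsAncientMildSolution 1 u ∧ (∀ t < 0, AEStronglyMeasurable (u t) volume) ∧
        (∀ c : ℝ, 0 < c → IsRotatedDSS c (Rot (2 * α * Real.log c)) u) ∧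
          (∃ C₀ : ℝ, HasTypeIDecay C₀ u) ∧ (∀ g ∈ G, ∀ t x, u t (g x) = g (u t x)) ∧
            ¬ (∀ t < 0, u t =ᵐ[volume] 0)

end

end Summit.NavierStokesRegularity.NavierStokesRegularity.Cruxes.PolyhedralDssProfileExists.StrategistS19g5
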